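import Summits.CriticalPhenomena.Ising3DConformalLimit.Theorems.PerfectScreeningGaussianLimitNotScreenedOneArmAsymptoticsEstimates
import Summits.CriticalPhenomena.Ising3DConformalLimit.Theorems.PerfectScreeningGaussianLimitNotScreenedOneArmAsymptoticsGeometry
import Summits.CriticalPhenomena.Ising3DConformalLimit.Theorems.PerfectScreeningGaussianLimitNotScreenedDyadicShellSums
import HarnessLib

/-!
# Crux `GaussianLimitNotScreened` (stmt-CriticalPhenomena-13886, route PerfectScreening r4), line
# `karamata-amplitude-blind-merging`: the registered stub `stub_oneArmAsymptotics` (STUB 2c — one-arm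
# moment asymptotics on the counting region)

THEOREM-ONLY file. For a non-degenerate pointwise scaling limit `S` of the critical Ising₃ correlators
(renormalisation `ρ > 0` on `(0,1]`), scale covariant on non-coincident configurations with exponent
`Δ`, an exponent `0 < s < 3 − 2Δ` and a non-coincident quadruple `x`, there are `K, c₁, c₂ > 0` such
that on the counting regions `A(δ) = Λ_{⌊1/δ⌋−1} + [z/δ]`, `z = (∑ᵢ‖xᵢ‖ + 5)e₀` (those of the landed
`stub_momentRatioLowerBound` of crux 0636), for all small `δ` and then all large `L`, with
`a = x̃₀, b = x̃₁`, `R = ‖x̃₂ − x̃₃‖` and the one-arm moments `M₁, M₂, E_s` of the free box at `β_c`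
(`PerfectScreeningGaussianLimitNotScreenedDefs`):
`A(δ) ⊆ Λ_L`, `x̃₂, x̃₃ ∉ A(δ)`, `A(δ) ⊂ B(x̃₂, KR)`, `M₁² ≥ c₁M₂ > 0`, `E_s ≤ c₂R^{−s}M₁²`, `2Rˢ ≤ M₁`.

Proof (`oneArmAsymptotics_of_dyadicShellSums`, then `stub_oneArmAsymptotics` by plugging in the landed
neighbour stub `stub_dyadicShellSums` at the exponents `0` and `s`): the two-point window
`ℓ ≤ ρ(δ)²⟨σσ⟩ ≤ U` (`stub_momentRatioWindow`) gives `M₁ ≥ |A|ℓ²/(Uρ²)` and bounds every two-step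
term by `(2U²/(ℓρ²))⟨σ_vσ_w⟩`; translation invariance and the dyadic shell sums bound the inner sums
by `K n³ U/ρ²` (times `2^sC^sR^{−s}` for the weighted one, `R ≤ Cn`), so that `ρ(δ)²` CANCELS in
`M₁²/M₂ ≥ c₁` and in `E_sRˢ/M₁² ≤ c₂`; the mass threshold `2Rˢ < M₁` uses `1/ρ² ≥ ⟨σ_{x̃₀}σ_{x̃₁}⟩/U`
and the lower bound `⟨σ₀σ_y⟩ ≥ ‖y‖^{−2Δ−ε}` from the existence of `η = 2Δ − 1`
(`ε = (3 − 2Δ − s)/2`), i.e. `M₁ ≳ δ^{−(3−2Δ−ε)} ≫ δ^{−s} ≍ Rˢ`; the region geometry is the floor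
geometry of `[·/δ]`; finally `Λ_L ↑ ℤ³` termwise turns the strict infinite-volume inequalities into the
eventual box inequalities (helper files `…OneArmAsymptoticsEstimates`, `…OneArmAsymptoticsGeometry`).

References: M. Aizenman, H. Duminil-Copin, Ann. of Math. 194 (2021) = arXiv:1912.07973, §4.2 Lemma 4.4,
App. A Prop. A.3; N. H. Bingham, C. M. Goldie, J. L. Teugels, Regular Variation (1987), §1.5–1.6.
-/

noncomputable section

open Filter Topology Set Function MeasureTheory Finset
open Literature.Probability.LatticeModels Literature.Probability.Percolation
open Summit.CriticalPhenomena.Ising3DConformalLimit.Cruxes.IsingEuclidUpgradeR4NonGaussian.FreeCovarianceDeltaDichotomy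
  (lat boxG threePointRatio twoStep ScaleCovariantOn criticalCorr_two_pos' stub_momentRatioWindow
    eventually_lat_mem_box)
open scoped symmDiff

namespace Summit.CriticalPhenomena.Ising3DConformalLimit.Cruxes.GaussianLimitNotScreened.KaramataAmplitudeBlindMerging

section Main

open OneArm

/-- **`stub_oneArmAsymptotics` from the dyadic shell sums.** Given the two Karamata dyadic bounds
(`∑_{0<‖u‖≤2^{J+2}} ⟨σ₀σ_u⟩ ≤ K₀8^J⟨σ₀σ_{2^Je₀}⟩` and its `‖u‖^{-s}`-weighted version) as hypotheses,
the one-arm moments on the counting region `A(δ) = Λ_{⌊1/δ⌋−1} + [z/δ]`, `z = (∑ᵢ‖xᵢ‖+5)e₀`, satisfy,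
for small `δ` and then large `L`: `A(δ) ⊆ Λ_L` avoids `x̃₂, x̃₃` and lies in the `K R`-ball of `x̃₂`
(`R = ‖x̃₂ − x̃₃‖`), `M₁² ≥ c₁M₂ > 0`, `E_s ≤ c₂R^{-s}M₁²`, `2Rˢ ≤ M₁`.
[cite: AizenmanDuminilCopinAnnals2021, §4.2 Lemma 4.4 and App. A Prop. A.3] -/
theorem oneArmAsymptotics_of_dyadicShellSums {ρ : ℝ → ℝ} {S : CorrFamily 3} {Δ : ℝ}
    (hρ : ∀ δ ∈ Set.Ioc (0:ℝ) 1, 0 < ρ δ) (hlim : HasPointwiseScalingLimit (criticalCorr 3) ρ S)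
    (hnd : IsNondegenerateTwoPoint S) (hcov : ScaleCovariantOn Δ S) {s : ℝ} (hs₀ : 0 < s)
    (hs : s < 3 - 2 * Δ) {K₀ : ℝ} (hK₀ : 0 < K₀) {i₀ : ℕ}
    (hsum₀ : ∀ J : ℕ, i₀ ≤ J → ∑ u ∈ (box 3 (2 ^ (J + 2))).erase 0, criticalTwoPoint 3 u ≤
      K₀ * (8 : ℝ) ^ J * criticalTwoPoint 3 (Pi.single (0 : Fin 3) ((2 : ℤ) ^ J)))
    {K₁ : ℝ} (hK₁ : 0 < K₁) {i₁ : ℕ}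
    (hsum₁ : ∀ J : ℕ, i₁ ≤ J →
      ∑ u ∈ (box 3 (2 ^ (J + 2))).erase 0, (‖u‖ : ℝ) ^ (-s) * criticalTwoPoint 3 u ≤
        K₁ * (8 : ℝ) ^ J * (2 : ℝ) ^ (-(s * J)) * criticalTwoPoint 3 (Pi.single (0 : Fin 3) ((2 : ℤ) ^ J)))
    {x : Fin 4 → EuclideanSpace ℝ (Fin 3)} (hx : x ∈ NonCoincident 3 4) :
    ∃ K c₁ c₂ : ℝ, 0 < K ∧ 0 < c₁ ∧ 0 < c₂ ∧ ∃ A : ℝ → Finset (Site 3),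
      ∀ᶠ δ in 𝓝[>] (0:ℝ), ∀ᶠ L : ℕ in atTop,
        A δ ⊆ box 3 L ∧ lat δ x 2 ∉ A δ ∧ lat δ x 3 ∉ A δ ∧
        (∀ u ∈ A δ, (‖u - lat δ x 2‖ : ℝ) ≤ K * ‖lat δ x 2 - lat δ x 3‖) ∧
        0 < oneArmMoment₂ L (lat δ x 0) (lat δ x 1) (A δ) ∧
        c₁ * oneArmMoment₂ L (lat δ x 0) (lat δ x 1) (A δ) ≤
          oneArmMoment₁ L (lat δ x 0) (lat δ x 1) (A δ) ^ 2 ∧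
        energyMoment L (lat δ x 0) (lat δ x 1) s (A δ) ≤
          c₂ * (‖lat δ x 2 - lat δ x 3‖ : ℝ) ^ (-s) * oneArmMoment₁ L (lat δ x 0) (lat δ x 1) (A δ) ^ 2 ∧
        2 * (‖lat δ x 2 - lat δ x 3‖ : ℝ) ^ s ≤ oneArmMoment₁ L (lat δ x 0) (lat δ x 1) (A δ) := by
  classical
  have hinj : Function.Injective x := hx
  set G : Site 3 → Site 3 → ℝ := fun u v => criticalCorr 3 2 ![u, v] with hGdef
  have hG : ∀ u v, G u v = criticalCorr 3 2 ![u, v] := fun u v => rfl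
  have hGp : ∀ u v : Site 3, 0 < G u v := fun u v => criticalCorr_two_pos' u v
  /- ① the window in `Δ`, `η`, the two-point window, the axis shell -/
  obtain ⟨hΔ, hη⟩ := window_and_eta_of_covOn hρ hlim hnd hcov
  obtain ⟨ℓ, U, hℓpos, hℓU, hwin⟩ := stub_momentRatioWindow ρ S hlim hnd x hx
  have hUpos : 0 < U := hℓpos.trans_le hℓU
  obtain ⟨c₀, hc₀, hshell⟩ := one_le_axis_shell
  set ε : ℝ := (3 - 2 * Δ - s) / 2 with hε
  have hεpos : 0 < ε := by rw [hε]; linarith only [hs]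
  set p : ℝ := 2 * Δ + ε with hp
  have hp0 : 0 ≤ p := by rw [hp]; linarith only [hΔ.1, hεpos]
  obtain ⟨B, hB⟩ := rpow_le_criticalTwoPoint_of_eta hη hεpos
  /- geometric constants -/
  set Sx : ℝ := ∑ j, ‖x j‖ with hSx
  have hSx0 : 0 ≤ Sx := Finset.sum_nonneg fun j _ => norm_nonneg (x j)
  set z : EuclideanSpace ℝ (Fin 3) := (Sx + 5) • EuclideanSpace.single (0 : Fin 3) (1:ℝ) with hz
  set D₀₁ : ℝ := ‖WithLp.ofLp (x 1) - WithLp.ofLp (x 0)‖ with hD₀₁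
  set D₂₃ : ℝ := ‖WithLp.ofLp (x 2) - WithLp.ofLp (x 3)‖ with hD₂₃
  have hD₀₁pos : 0 < D₀₁ := by
    rw [hD₀₁, norm_pos_iff, sub_ne_zero]
    intro h
    exact absurd (hinj ((WithLp.ofLp_injective 2) h)) (by decide)
  have hD₂₃pos : 0 < D₂₃ := by
    rw [hD₂₃, norm_pos_iff, sub_ne_zero]
    intro h
    exact absurd (hinj ((WithLp.ofLp_injective 2) h)) (by decide)
  set B' : ℝ := max B 1 with hB'
  /- ② the constants -/
  set K : ℝ := 2 * (2 * Sx + 8) / D₂₃ with hK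
  set Kb : ℝ := K₀ + c₀⁻¹ with hKb
  have hKbpos : 0 < Kb := by rw [hKb]; positivity
  set c₁ : ℝ := ℓ ^ 5 / (4 * Kb * U ^ 5) with hc₁
  set CR : ℝ := 3 * (D₂₃ + 2) with hCR
  set w : ℝ := (2:ℝ) ^ s * CR ^ s with hw
  have hwpos : 0 < w := by rw [hw]; positivity
  set c₂ : ℝ := 4 * w * K₁ * U ^ 5 / ℓ ^ 5 with hc₂
  set Q : ℝ := 2 * (D₂₃ + 2) ^ s * U ^ 2 * (D₀₁ + 2) ^ p / ℓ ^ 2 with hQ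
  refine ⟨K, c₁, c₂, by positivity, by positivity, by positivity,
    fun δ => (box 3 (⌊δ⁻¹⌋₊ - 1)).image (fun u => u + latticeApprox δ z), ?_⟩
  /- ③ eventualities in `δ` -/
  set i₂ : ℕ := max i₀ i₁ with hi₂
  set δ₁ : ℝ := min (min (1/4) ((2:ℝ) ^ i₂ + 2)⁻¹) (min (D₂₃ / 4) (D₀₁ / (B' + 2))) with hδ₁
  have hB'2 : 0 < B' + 2 := by have h := le_max_right B 1; linarith only [h]
  have hδ₁pos : 0 < δ₁ := lt_min (lt_min (by norm_num) (by positivity)) (lt_min (by positivity) (by positivity))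
  have E1 : ∀ᶠ δ in 𝓝[>] (0:ℝ), δ ∈ Set.Ioo 0 δ₁ := Ioo_mem_nhdsGT hδ₁pos
  have E2 : ∀ᶠ δ in 𝓝[>] (0:ℝ), Q < δ⁻¹ ^ ε :=
    (tendsto_rpow_atTop hεpos).comp tendsto_inv_nhdsGT_zero |>.eventually_gt_atTop Q
  have E3 : ∀ᶠ δ in 𝓝[>] (0:ℝ), δ ∈ Set.Ioc (0:ℝ) 1 := Ioc_mem_nhdsGT one_pos
  filter_upwards [hwin, E1, E2, E3] with δ hw h1 hmassQ h3
  obtain ⟨hGab, -, hGreg, hGtop⟩ := hw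
  obtain ⟨hδpos, hδlt⟩ := h1
  have hδ4 : δ ≤ 1/4 := hδlt.le.trans ((min_le_left _ _).trans (min_le_left _ _))
  have hδ1 : δ ≤ 1 := hδ4.trans (by norm_num)
  have hδlt1 : δ < 1 := hδ4.trans_lt (by norm_num)
  have hδi : δ < ((2:ℝ) ^ i₂ + 2)⁻¹ := hδlt.trans_le ((min_le_left _ _).trans (min_le_right _ _))
  have hδD : 4 * δ ≤ D₂₃ := by
    have h := hδlt.le.trans ((min_le_right _ _).trans (min_le_left _ _)); linarith only [h]
  have hδB : δ ≤ D₀₁ / (B' + 2) := hδlt.le.trans ((min_le_right _ _).trans (min_le_right _ _))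
  set r : ℝ := ρ δ ^ 2 with hr
  have hrpos : 0 < r := pow_pos (hρ δ h3) 2
  /- the mesh integers -/
  obtain ⟨⟨hn1δ, hn34⟩, ⟨hi₂n, hn1⟩, ⟨hJn, hnJ, hi₂J⟩, ht4, ht1⟩ := mesh_integers hδpos hδ4 hδi
  set n : ℕ := ⌊δ⁻¹⌋₊ - 1 with hn
  set J : ℕ := Nat.log 2 n with hJ
  have hn0 : 0 < n := hn1
  have hnpos : (0:ℝ) < n := by exact_mod_cast hn0
  have hi₀J : i₀ ≤ J := le_trans (le_max_left _ _) hi₂J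
  have hi₁J : i₁ ≤ J := le_trans (le_max_right _ _) hi₂J
  -- `T = 1/δ` against `n`
  have hTn : δ⁻¹ ≤ 3 * n := by
    have h := Nat.lt_floor_add_one (δ⁻¹)
    have e : ((⌊δ⁻¹⌋₊ : ℕ) : ℝ) = n + 1 := by
      have : n + 1 = ⌊δ⁻¹⌋₊ := by omega
      rw [← this]; push_cast; ring
    rw [e] at h
    have h1 : (1:ℝ) ≤ n := by exact_mod_cast hn1
    linarith only [h, h1]
  /- the region, the sources -/
  set q : Site 3 := latticeApprox δ z with hq
  set A : Finset (Site 3) := (box 3 n).image (fun u => u + q) with hA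
  have hcardA : #A = (2 * n + 1) ^ 3 := by
    rw [hA, Finset.card_image_of_injective _ (add_left_injective q), card_box]
  have hAne : A.Nonempty := by rw [hA]; exact Finset.image_nonempty.2 ⟨0, zero_mem_box 3 n⟩
  have hn3A : (n:ℝ) ^ 3 ≤ #A := by
    rw [hcardA]; push_cast
    exact pow_le_pow_left₀ (by positivity) (by linarith only [hnpos]) 3
  set a : Site 3 := lat δ x 0 with ha
  set b : Site 3 := lat δ x 1 with hb
  set c : Site 3 := lat δ x 2 with hc
  set e : Site 3 := lat δ x 3 with he
  -- the window on the region and at the top axis scale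
  have hGab' : ℓ ≤ r * G a b ∧ r * G a b ≤ U := hGab
  have hAlo : ∀ v ∈ A, ℓ ≤ r * G a v ∧ ℓ ≤ r * G v b := by
    intro v hv
    obtain ⟨u, hu, rfl⟩ := Finset.mem_image.1 hv
    refine ⟨(hGreg n hn1δ 0 u hu).1, ?_⟩
    rw [show G (u + q) b = G b (u + q) from criticalCorr_two_pair_comm _ _]
    exact (hGreg n hn1δ 1 u hu).1
  have hAhi : ∀ v ∈ A, r * G a v ≤ U ∧ r * G v b ≤ U := by
    intro v hv
    obtain ⟨u, hu, rfl⟩ := Finset.mem_image.1 hv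
    refine ⟨(hGreg n hn1δ 0 u hu).2, ?_⟩
    rw [show G (u + q) b = G b (u + q) from criticalCorr_two_pair_comm _ _]
    exact (hGreg n hn1δ 1 u hu).2
  have htop : r * criticalTwoPoint 3 (Pi.single (0 : Fin 3) ((2:ℤ) ^ J)) ≤ U := by
    have h := hGtop (2 ^ J) (by push_cast; exact ht4) (by push_cast; exact ht1)
    push_cast at h
    exact h
  /- ④ geometry: the region avoids `x̃₂, x̃₃` and sits in the `K R`-ball of `x̃₂` -/
  set R : ℝ := ‖c - e‖ with hR
  have hRlo : D₂₃ / (2 * δ) ≤ R := half_div_le_norm_lat_sub hδpos (x 2) (x 3) hδD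
  have hRpos : 0 < R := lt_of_lt_of_le (by positivity) hRlo
  have hRT : R ≤ (D₂₃ + 2) * δ⁻¹ := by
    rw [← div_eq_mul_inv]; exact norm_lat_sub_le_div hδpos hδ1 (x 2) (x 3)
  have hRn : R ≤ CR * n := by
    refine hRT.trans ?_
    calc (D₂₃ + 2) * δ⁻¹ ≤ (D₂₃ + 2) * (3 * n) := mul_le_mul_of_nonneg_left hTn (by positivity)
      _ = CR * n := by rw [hCR]; ring
  have hnotin : ∀ i : Fin 4, lat δ x i ∉ A := by
    intro i hi
    obtain ⟨u, hu, hu'⟩ := Finset.mem_image.1 hi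
    exact region_point_ne_lat x hδpos hδlt1 hn1δ hu i hu'
  have hball : ∀ u ∈ A, (‖u - c‖ : ℝ) ≤ K * R := by
    intro v hv
    obtain ⟨u, hu, rfl⟩ := Finset.mem_image.1 hv
    have h := norm_region_point_sub_lat_le x hδpos hδ1 hn1δ hu 2
    refine h.trans ?_
    calc (2 * Sx + 8) / δ = K * (D₂₃ / (2 * δ)) := by rw [hK]; field_simp
      _ ≤ K * R := mul_le_mul_of_nonneg_left hRlo (by positivity)
  /- ⑤ the infinite-volume moments and their bounds -/
  set M₁ : ℝ := ∑ v ∈ A, G a v * G v b / G a b with hM₁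
  set M₂ : ℝ := ∑ v ∈ A, ∑ w ∈ A, (G a v * G v w * G w b + G a w * G w v * G v b) / G a b with hM₂
  set E : ℝ := ∑ v ∈ A, ∑ w ∈ A.erase v, (‖v - w‖ : ℝ) ^ (-s) *
    ((G a v * G v w * G w b + G a w * G w v * G v b) / G a b) with hE
  have hM₁lo : (#A : ℝ) * (ℓ ^ 2 / (U * r)) ≤ M₁ := moment₁_lower hG hrpos hℓpos hGab'.2 hAlo
  have hM₁pos : 0 < M₁ := lt_of_lt_of_le (mul_pos (by exact_mod_cast hAne.card_pos) (by positivity)) hM₁lo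
  have hM₂pos : 0 < M₂ := by
    refine Finset.sum_pos (fun v _ => Finset.sum_pos (fun w _ => ?_) hAne) hAne
    refine div_pos (add_pos ?_ ?_) (hGp _ _) <;> exact mul_pos (mul_pos (hGp _ _) (hGp _ _)) (hGp _ _)
  have hM₂hi : M₂ ≤ 2 * U ^ 2 / (ℓ * r) * ((#A : ℝ) * (Kb * (n:ℝ) ^ 3 * (U / r))) := by
    refine (moment₂_upper hG hrpos hℓpos hGab'.1 hAhi).trans ?_
    refine mul_le_mul_of_nonneg_left ?_ (by positivity)
    rw [← nsmul_eq_mul, ← Finset.sum_const]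
    refine Finset.sum_le_sum fun v hv => ?_
    exact (sum_region_sub_le criticalTwoPoint_nonneg' n q hv).trans
      (sum_box_two_mul_le hJn hnJ (hsum₀ J hi₀J) (hshell J) hKbpos.le hrpos htop)
  have hRs0 : 0 ≤ R ^ (-s) := Real.rpow_nonneg (norm_nonneg _) _
  have hEhi : E ≤ 2 * U ^ 2 / (ℓ * r) * ((#A : ℝ) * (K₁ * (n:ℝ) ^ 3 * (w * R ^ (-s)) * (U / r))) := by
    refine (energy_upper hG hrpos hℓpos s hGab'.1 hAhi).trans ?_
    refine mul_le_mul_of_nonneg_left ?_ (by positivity)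
    rw [← nsmul_eq_mul, ← Finset.sum_const]
    refine Finset.sum_le_sum fun v hv => ?_
    exact (sum_region_erase_sub_le (f := fun y => (‖y‖ : ℝ) ^ (-s) * criticalTwoPoint 3 y)
      (fun y => mul_nonneg (Real.rpow_nonneg (norm_nonneg _) _) (criticalTwoPoint_nonneg' y)) n q hv).trans
      (wsum_box_two_mul_le hs₀ hJn hnJ hK₁.le (hsum₁ J hi₁J) hrpos htop hRpos (by positivity) hRn)
  /- ⑥ the three strict inequalities in infinite volume -/
  have hkey₁ : c₁ * M₂ < M₁ ^ 2 := by
    have h := ratio_arith hℓpos hUpos hrpos hKbpos (by positivity) hn3A hM₁lo hM₂hi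
    have h' : 0 < c₁ * M₂ := mul_pos (by positivity) hM₂pos
    rw [hc₁] at h' ⊢; linarith only [h, h']
  have hkey₂ : E < c₂ * R ^ (-s) * M₁ ^ 2 := by
    have h := energy_arith hℓpos hUpos hrpos hK₁.le (mul_nonneg hwpos.le hRs0) (by positivity)
      hn3A hM₁lo hEhi
    have hpos : 0 < c₂ * R ^ (-s) * M₁ ^ 2 :=
      mul_pos (mul_pos (by positivity) (Real.rpow_pos_of_pos hRpos _)) (pow_pos hM₁pos 2)
    have e1 : 4 * (w * R ^ (-s)) * K₁ * U ^ 5 / ℓ ^ 5 / 2 * M₁ ^ 2 = c₂ * R ^ (-s) * M₁ ^ 2 / 2 := by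
      rw [hc₂]; ring
    rw [e1] at h
    linarith only [h, hpos]
  have hkey₃ : 2 * R ^ s < M₁ := by
    have hTpos : 0 < δ⁻¹ := by positivity
    -- the source pair
    have hyhi : (‖b - a‖ : ℝ) ≤ (D₀₁ + 2) * δ⁻¹ := by
      rw [← div_eq_mul_inv]; exact norm_lat_sub_le_div hδpos hδ1 (x 1) (x 0)
    have hylo : B' ≤ (‖b - a‖ : ℝ) := by
      have h := le_norm_lat_sub hδpos (x 1) (x 0)
      have h2 : B' + 2 ≤ D₀₁ / δ := by
        rw [le_div_iff₀ hδpos]; rw [le_div_iff₀ hB'2] at hδB; linarith only [hδB]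
      linarith only [h, h2]
    have hypos : 0 < (‖b - a‖ : ℝ) := lt_of_lt_of_le (by positivity) ((le_max_right B 1).trans hylo)
    have hgy : (‖b - a‖ : ℝ) ^ (-p) ≤ G a b := by
      rw [hG, criticalCorr_two_pair]
      have := hB (b - a) ((le_max_left B 1).trans hylo)
      rwa [show (-(1 + (2 * Δ - 1) + ε)) = -p by rw [hp]; ring] at this
    have hg : ((D₀₁ + 2) * δ⁻¹) ^ (-p) ≤ G a b :=
      (Real.rpow_le_rpow_of_nonpos hypos hyhi (by linarith only [hp0])).trans hgy
    -- `M₁ ≥ T³ ℓ² G(a,b)/U²`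
    have hT3 : δ⁻¹ ^ (3:ℝ) ≤ #A := by
      rw [show (3:ℝ) = ((3:ℕ):ℝ) by norm_num, Real.rpow_natCast, hcardA]
      push_cast
      refine pow_le_pow_left₀ hTpos.le ?_ 3
      have h1 : 3/4 * δ⁻¹ ≤ ((n:ℝ) + 1) * δ * δ⁻¹ := mul_le_mul_of_nonneg_right hn34 (by positivity)
      rw [mul_assoc, mul_inv_cancel₀ hδpos.ne', mul_one] at h1
      have h2 : (4:ℝ) ≤ δ⁻¹ := by rw [← one_div, le_div_iff₀ hδpos]; linarith only [hδ4]
      linarith only [h1, h2]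
    have hM : δ⁻¹ ^ (3:ℝ) * (ℓ ^ 2 * G a b / U ^ 2) ≤ M₁ := by
      refine le_trans ?_ hM₁lo
      refine mul_le_mul hT3 ?_ (by have := hGp a b; positivity) (by positivity)
      rw [div_le_div_iff₀ (by positivity) (by positivity)]
      have h1 := mul_le_mul_of_nonneg_left hGab'.2 (by positivity : (0:ℝ) ≤ ℓ ^ 2 * U)
      linarith only [h1]
    exact mass_arith hTpos hℓpos hUpos (by positivity) (by positivity) hs₀
      (by rw [hε, hp]; ring) hg hM hRT hRpos hmassQ
  /- ⑦ `Λ_L ↑ ℤ³` -/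
  have T₁ := tendsto_oneArmMoment₁ hG a b A
  have T₂ := tendsto_oneArmMoment₂ hG a b A
  have T₃ := tendsto_energyMoment hG a b s A
  have L1 : ∀ᶠ L : ℕ in atTop, A ⊆ box 3 L := (eventually_lat_mem_box δ x A).mono fun L h => h.2
  have L2 : ∀ᶠ L : ℕ in atTop, 0 < oneArmMoment₂ L a b A := T₂.eventually_const_lt hM₂pos
  have L3 : ∀ᶠ L : ℕ in atTop, c₁ * oneArmMoment₂ L a b A < oneArmMoment₁ L a b A ^ 2 :=
    (T₂.const_mul c₁).eventually_lt (T₁.pow 2) hkey₁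
  have L4 : ∀ᶠ L : ℕ in atTop, energyMoment L a b s A < c₂ * R ^ (-s) * oneArmMoment₁ L a b A ^ 2 :=
    T₃.eventually_lt ((T₁.pow 2).const_mul _) hkey₂
  have L5 : ∀ᶠ L : ℕ in atTop, 2 * R ^ s < oneArmMoment₁ L a b A := T₁.eventually_const_lt hkey₃
  filter_upwards [L1, L2, L3, L4, L5] with L h1 h2 h3 h4 h5
  exact ⟨h1, hnotin 2, hnotin 3, hball, h2, h3.le, h4.le, h5.le⟩

/-- **Registered stub `stub_oneArmAsymptotics` — ONE-ARM MOMENT ASYMPTOTICS ON THE COUNTING REGION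
(STUB 2c of the line `karamata-amplitude-blind-merging`).** For a non-degenerate pointwise scaling limit
of `criticalCorr 3` (`ρ > 0` on `(0,1]`), scale covariant on non-coincident configurations with
exponent `Δ`, `0 < s < 3 − 2Δ` and a non-coincident quadruple `x`: constants `K, c₁, c₂ > 0` and
counting regions `A(δ) = Λ_{⌊1/δ⌋−1} + [z/δ]`, `z = (∑ᵢ‖xᵢ‖ + 5)e₀`, such that for all small `δ` and then
all large `L` (`a = x̃₀, b = x̃₁`, `R = ‖x̃₂ − x̃₃‖`): `A(δ) ⊆ Λ_L` avoids `x̃₂, x̃₃` and lies in the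
`K R`-ball of `x̃₂`; `M₁² ≥ c₁ M₂ > 0`; `E_s ≤ c₂ R^{−s} M₁²`; `2Rˢ ≤ M₁` — the window
`stub_momentRatioWindow`, the dyadic shell sums `stub_dyadicShellSums` at `0` and at `s`, the
existence of `η = 2Δ − 1`, and `Λ_L ↑ ℤ³` termwise. [cite: AizenmanDuminilCopinAnnals2021, §4.2 Lemma 4.4 and App. A Prop. A.3] -/
theorem stub_oneArmAsymptotics :
    ∀ (ρ : ℝ → ℝ) (S : CorrFamily 3) (Δ : ℝ), (∀ δ ∈ Set.Ioc (0:ℝ) 1, 0 < ρ δ) →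
      HasPointwiseScalingLimit (criticalCorr 3) ρ S → IsNondegenerateTwoPoint S →
      ScaleCovariantOn Δ S → ∀ s : ℝ, 0 < s → s < 3 - 2 * Δ →
      ∀ x ∈ NonCoincident 3 4, ∃ K c₁ c₂ : ℝ, 0 < K ∧ 0 < c₁ ∧ 0 < c₂ ∧ ∃ A : ℝ → Finset (Site 3),
        ∀ᶠ δ in 𝓝[>] (0:ℝ), ∀ᶠ L : ℕ in atTop,
          A δ ⊆ box 3 L ∧ lat δ x 2 ∉ A δ ∧ lat δ x 3 ∉ A δ ∧
          (∀ u ∈ A δ, (‖u - lat δ x 2‖ : ℝ) ≤ K * ‖lat δ x 2 - lat δ x 3‖) ∧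
          0 < oneArmMoment₂ L (lat δ x 0) (lat δ x 1) (A δ) ∧
          c₁ * oneArmMoment₂ L (lat δ x 0) (lat δ x 1) (A δ) ≤
            oneArmMoment₁ L (lat δ x 0) (lat δ x 1) (A δ) ^ 2 ∧
          energyMoment L (lat δ x 0) (lat δ x 1) s (A δ) ≤
            c₂ * (‖lat δ x 2 - lat δ x 3‖ : ℝ) ^ (-s) * oneArmMoment₁ L (lat δ x 0) (lat δ x 1) (A δ) ^ 2 ∧
          2 * (‖lat δ x 2 - lat δ x 3‖ : ℝ) ^ s ≤ oneArmMoment₁ L (lat δ x 0) (lat δ x 1) (A δ) := by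
  intro ρ S Δ hρ hlim hnd hcov s hs₀ hs x hx
  have h2e := S_two_unitVec_eq_of_covOn hcov
  obtain ⟨K₀, hK₀, i₀, hsum₀⟩ := stub_dyadicShellSums ρ S Δ hlim hnd h2e 0 le_rfl (by linarith)
  obtain ⟨K₁, hK₁, i₁, hsum₁⟩ := stub_dyadicShellSums ρ S Δ hlim hnd h2e s hs₀.le hs
  have hsum₀' : ∀ J : ℕ, i₀ ≤ J → ∑ u ∈ (box 3 (2 ^ (J + 2))).erase 0, criticalTwoPoint 3 u ≤
      K₀ * (8 : ℝ) ^ J * criticalTwoPoint 3 (Pi.single (0 : Fin 3) ((2 : ℤ) ^ J)) := by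
    intro J hJ
    have h := hsum₀ J hJ
    simp only [neg_zero, Real.rpow_zero, one_mul, zero_mul, mul_one] at h
    exact h
  exact oneArmAsymptotics_of_dyadicShellSums hρ hlim hnd hcov hs₀ hs hK₀ hsum₀' hK₁ hsum₁ hx

end Main

end Summit.CriticalPhenomena.Ising3DConformalLimit.Cruxes.GaussianLimitNotScreened.KaramataAmplitudeBlindMerging

end
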